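import Summits.QuantumAdvantage.AdviceFreeQNC0.WalkPolynomialTransforms
import HarnessLib

/-!
# Cell qa-qnc0 (rung F-Q1, route RingFrame, crux α `RingToElim`): the ADAPTED far pattern —
# alternating along the complement of a small set stays far from the path

Fourth layer of the `𝔽₄`-character toolkit (`WalkCharacters.lean` … `WalkPolynomialTransforms.lean`;
planner qa-qnc0-p1 TARGET §15), used by the sharp interpolation theorem
`WalkFailSetHitsSharp.lean`.  `WalkFailSetHits.lean` flipped the GLOBAL alternating pattern
inside a set `S₀` of `≤ D'` positions, which can move it `D'` closer to the path; alternating ALONG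
THE COMPLEMENT `R = [m] ∖ S₀` (letter `2` at the odd-ranked elements of `R`) costs only the `|S₀|`
deleted letters:

* `rk`, `rk_lt_rk`, `rk_lt_card`, `rk_injOn`, `image_rk`, **`lt_iff_rk_lt`** — ranks inside `R`
  (a threshold `i < g` on `R` is the threshold `rk i < #{r ∈ R : r < g}` on ranks);
* `altAlong R` and **`card_mis_altAlong`**, **`card_mis_conj_altAlong`** — its mismatches with a
  path pattern, counted inside `R`, are those of `alt` / `conj alt` on `|R|` letters with a path
  pattern there (closed forms `pdist_alt_aPat_eq`, `pdist_aPat_conjAlt` of `WalkPhaseLaw.lean`);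
* `card_filter_le_pdist_flipOn`; **`far_flipOn_altAlong`** — for `|S₀| ≤ D'`, `T ⊆ S₀` and
  `m ≥ 2D + 3D' + 3`, the pattern `σ_T (altAlong R)` and its conjugate are at distance `> D' + D`
  from every path pattern.

The cell's lemmas (prover qn-prover-3 gen 6), 2026-08-27; elementary, not in print in this form.
WHAT THIS IS NOT: no statement about the game; no separation claim.
-/

noncomputable section

namespace Summit.QuantumAdvantage.AdviceFreeQNC0

open Finset
open Literature.Computability.MetaComplexity Literature.Computability.MetaComplexity.Smolensky
open F4

variable {m : ℕ}


/-! ### Ranks inside a set of positions -/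

/-- The rank of position `i` in `R`: the number of elements of `R` below `i`. -/
def rk (R : Finset (Fin m)) (i : Fin m) : ℕ := (R.filter fun r => r < i).card

/-- Ranks increase strictly along `R`. -/
theorem rk_lt_rk {R : Finset (Fin m)} {i i' : Fin m} (hi : i ∈ R) (h : i < i') : rk R i < rk R i' := by
  unfold rk
  refine Finset.card_lt_card ⟨fun r hr => ?_, fun hsub => ?_⟩
  · rw [Finset.mem_filter] at hr ⊢
    exact ⟨hr.1, lt_trans hr.2 h⟩
  · have : i ∈ R.filter fun r => r < i := hsub (Finset.mem_filter.2 ⟨hi, h⟩)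
    exact lt_irrefl _ (Finset.mem_filter.1 this).2

/-- Ranks of elements are below `|R|`. -/
theorem rk_lt_card {R : Finset (Fin m)} {i : Fin m} (hi : i ∈ R) : rk R i < R.card := by
  unfold rk
  refine Finset.card_lt_card ⟨Finset.filter_subset _ _, fun hsub => ?_⟩
  have : i ∈ R.filter fun r => r < i := hsub hi
  exact lt_irrefl _ (Finset.mem_filter.1 this).2

/-- The rank is injective on `R`. -/
theorem rk_injOn (R : Finset (Fin m)) : Set.InjOn (rk R) (R : Set (Fin m)) := by
  intro i hi i' hi' h
  rcases lt_trichotomy i i' with hlt | heq | hgt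
  · exact absurd h (ne_of_lt (rk_lt_rk (Finset.mem_coe.1 hi) hlt))
  · exact heq
  · exact absurd h (ne_of_gt (rk_lt_rk (Finset.mem_coe.1 hi') hgt))

/-- The ranks of `R` are exactly `0, …, |R|−1`. -/
theorem image_rk (R : Finset (Fin m)) : R.image (rk R) = range R.card := by
  classical
  refine (Finset.eq_of_subset_of_card_le (fun j hj => ?_) ?_)
  · rw [Finset.mem_image] at hj
    obtain ⟨i, hi, rfl⟩ := hj
    exact Finset.mem_range.2 (rk_lt_card hi)
  · rw [Finset.card_range, Finset.card_image_of_injOn (rk_injOn R)]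

/-- **Thresholds become thresholds**: for `i ∈ R`, `i < g` iff `rk i < #{r ∈ R : r < g}`. -/
theorem lt_iff_rk_lt {R : Finset (Fin m)} {i : Fin m} (hi : i ∈ R) (g : ℕ) :
    i.val < g ↔ rk R i < (R.filter fun r => r.val < g).card := by
  unfold rk
  constructor
  · intro h
    refine Finset.card_lt_card ⟨fun r hr => ?_, fun hsub => ?_⟩
    · rw [Finset.mem_filter] at hr ⊢
      exact ⟨hr.1, lt_trans (Fin.lt_def.1 hr.2) h⟩
    · have : i ∈ R.filter fun r => r < i := hsub (Finset.mem_filter.2 ⟨hi, h⟩)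
      exact lt_irrefl _ (Finset.mem_filter.1 this).2
  · intro h
    by_contra hge
    rw [not_lt] at hge
    refine absurd h (not_lt.2 (Finset.card_le_card fun r hr => ?_))
    rw [Finset.mem_filter] at hr ⊢
    exact ⟨hr.1, Fin.lt_def.2 (lt_of_lt_of_le hr.2 hge)⟩

/-! ### The adapted far pattern -/

/-- Alternate ALONG `R`: letter `2` at the elements of odd rank in `R` (letter `1` elsewhere). -/
def altAlong (R : Finset (Fin m)) (i : Fin m) : Bool := decide (rk R i % 2 = 1)

/-- Mismatches of `altAlong R` with a path pattern, counted inside `R`, are the mismatches of the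
alternating pattern on `|R|` letters with a path pattern there. -/
theorem card_mis_altAlong (R : Finset (Fin m)) (g : ℕ) :
    (R.filter fun i => altAlong R i ≠ aPat g i).card =
      pdist (alt : Fin R.card → Bool) (aPat (R.filter fun r => r.val < g).card) := by
  classical
  -- left side as a sum over `R` of a function of the rank
  have hL : (R.filter fun i => altAlong R i ≠ aPat g i).card =
      ∑ i ∈ R, (fun j : ℕ => if (j % 2 = 0 ∧ j < (R.filter fun r => r.val < g).card) ∨
        (j % 2 = 1 ∧ (R.filter fun r => r.val < g).card ≤ j) then 1 else 0) (rk R i) := by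
    rw [Finset.card_filter]
    refine Finset.sum_congr rfl fun i hi => ?_
    have hlt := lt_iff_rk_lt hi g
    unfold altAlong aPat
    simp only [ne_eq, decide_eq_decide]
    by_cases h1 : rk R i % 2 = 1 <;> by_cases h2 : i.val < g <;> simp [h1, h2] <;> omega
  -- reindex by the rank
  have hsum := Finset.sum_image (f := fun j : ℕ => if (j % 2 = 0 ∧ j < (R.filter fun r => r.val < g).card) ∨
        (j % 2 = 1 ∧ (R.filter fun r => r.val < g).card ≤ j) then 1 else 0)
    (fun i hi i' hi' h => rk_injOn R hi hi' h)
  rw [image_rk R] at hsum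
  -- right side as the same range sum
  have e : ∀ j : Fin R.card, (if alt j ≠ aPat (R.filter fun r => r.val < g).card j then 1 else 0) =
      if (j.val % 2 = 0 ∧ j.val < (R.filter fun r => r.val < g).card) ∨
        (j.val % 2 = 1 ∧ (R.filter fun r => r.val < g).card ≤ j.val) then 1 else 0 := by
    intro j
    by_cases h : alt j ≠ aPat (R.filter fun r => r.val < g).card j
    · rw [if_pos h, if_pos ((alt_ne_aPat_iff _ j).1 h)]
    · rw [if_neg h, if_neg fun h' => h ((alt_ne_aPat_iff _ j).2 h')]
  have h2 := Fin.sum_univ_eq_sum_range (fun j : ℕ => if (j % 2 = 0 ∧ j < (R.filter fun r => r.val < g).card) ∨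
        (j % 2 = 1 ∧ (R.filter fun r => r.val < g).card ≤ j) then 1 else 0) R.card
  beta_reduce at h2 hsum hL
  rw [hL, ← hsum, ← h2]
  unfold pdist
  rw [Finset.card_filter (fun j : Fin R.card => alt j ≠ aPat (R.filter fun r => r.val < g).card j) univ]
  exact (Finset.sum_congr rfl fun j _ => e j).symm

/-- The same for the conjugate pattern. -/
theorem card_mis_conj_altAlong (R : Finset (Fin m)) (g : ℕ) :
    (R.filter fun i => conj (altAlong R) i ≠ aPat g i).card =
      pdist (aPat (R.filter fun r => r.val < g).card) (conj (alt : Fin R.card → Bool)) := by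
  classical
  have hL : (R.filter fun i => conj (altAlong R) i ≠ aPat g i).card =
      ∑ i ∈ R, (fun j : ℕ => if (j % 2 = 1 ∧ j < (R.filter fun r => r.val < g).card) ∨
        (j % 2 = 0 ∧ (R.filter fun r => r.val < g).card ≤ j) then 1 else 0) (rk R i) := by
    rw [Finset.card_filter]
    refine Finset.sum_congr rfl fun i hi => ?_
    have hlt := lt_iff_rk_lt hi g
    unfold conj altAlong aPat
    simp only [ne_eq]
    by_cases h1 : rk R i % 2 = 1 <;> by_cases h2 : i.val < g <;> simp [h1, h2] <;> omega
  have hsum := Finset.sum_image (f := fun j : ℕ => if (j % 2 = 1 ∧ j < (R.filter fun r => r.val < g).card) ∨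
        (j % 2 = 0 ∧ (R.filter fun r => r.val < g).card ≤ j) then 1 else 0)
    (fun i hi i' hi' h => rk_injOn R hi hi' h)
  rw [image_rk R] at hsum
  have e : ∀ j : Fin R.card, (if aPat (R.filter fun r => r.val < g).card j ≠ conj alt j then 1 else 0) =
      if (j.val % 2 = 1 ∧ j.val < (R.filter fun r => r.val < g).card) ∨
        (j.val % 2 = 0 ∧ (R.filter fun r => r.val < g).card ≤ j.val) then 1 else 0 := by
    intro j
    by_cases h : aPat (R.filter fun r => r.val < g).card j ≠ conj alt j
    · rw [if_pos h, if_pos ((aPat_ne_conj_alt_iff _ j).1 h)]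
    · rw [if_neg h, if_neg fun h' => h ((aPat_ne_conj_alt_iff _ j).2 h')]
  have h2 := Fin.sum_univ_eq_sum_range (fun j : ℕ => if (j % 2 = 1 ∧ j < (R.filter fun r => r.val < g).card) ∨
        (j % 2 = 0 ∧ (R.filter fun r => r.val < g).card ≤ j) then 1 else 0) R.card
  beta_reduce at h2 hsum hL
  rw [hL, ← hsum, ← h2]
  unfold pdist
  rw [Finset.card_filter
    (fun j : Fin R.card => aPat (R.filter fun r => r.val < g).card j ≠ conj alt j) univ]
  exact (Finset.sum_congr rfl fun j _ => e j).symm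

/-- Mismatches outside the flipped set bound the distance from below. -/
theorem card_filter_le_pdist_flipOn {R T : Finset (Fin m)} (hTR : Disjoint T R) (b c : Fin m → Bool) :
    (R.filter fun i => b i ≠ c i).card ≤ pdist (flipOn T b) c := by
  classical
  unfold pdist
  refine Finset.card_le_card fun i hi => ?_
  rw [Finset.mem_filter] at hi ⊢
  have hiT : i ∉ T := fun h => Finset.disjoint_left.1 hTR h hi.1
  refine ⟨Finset.mem_univ _, ?_⟩
  unfold flipOn
  rw [if_neg hiT]
  exact hi.2

/-- **The adapted subcube is far**: for `|S₀| ≤ D'`, `T ⊆ S₀` and `m ≥ 2D + 3D' + 3`, the pattern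
`σ_T (altAlong ([m] ∖ S₀))` and its conjugate are at distance `> D' + D` from every path pattern. -/
theorem far_flipOn_altAlong {D D' : ℕ} (hm : 2 * D + 3 * D' + 3 ≤ m) {S₀ T : Finset (Fin m)}
    (hS : S₀.card ≤ D') (hT : T ⊆ S₀) :
    ¬ NearPath (D' + D) (flipOn T (altAlong (univ \ S₀))) ∧
      ¬ NearPath (D' + D) (conj (flipOn T (altAlong (univ \ S₀)))) := by
  classical
  set R : Finset (Fin m) := univ \ S₀ with hR
  have hRcard : R.card = m - S₀.card := by
    rw [hR, Finset.card_univ_sdiff, Fintype.card_fin]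
  have hdisj : Disjoint T R := by
    rw [hR]
    exact Finset.disjoint_left.2 fun i hi hi' => (Finset.mem_sdiff.1 hi').2 (hT hi)
  have hSm : S₀.card ≤ m := le_trans (Finset.card_le_univ S₀) (by rw [Fintype.card_fin])
  constructor
  · rintro ⟨g, hg⟩
    have h1 := card_filter_le_pdist_flipOn hdisj (altAlong R) (aPat g)
    rw [card_mis_altAlong R g, pdist_alt_aPat_eq] at h1
    have h3 : (R.filter fun r => r.val < g).card ≤ R.card := Finset.card_le_card (Finset.filter_subset _ _)
    rw [hRcard] at h1 h3
    revert h1 h3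
    generalize (R.filter fun r => r.val < g).card = g'
    intro h3 h1
    omega
  · rintro ⟨g, hg⟩
    rw [conj_flipOn] at hg
    have h1 := card_filter_le_pdist_flipOn hdisj (conj (altAlong R)) (aPat g)
    rw [card_mis_conj_altAlong R g, pdist_aPat_conjAlt] at h1
    have h3 : (R.filter fun r => r.val < g).card ≤ R.card := Finset.card_le_card (Finset.filter_subset _ _)
    rw [hRcard] at h1 h3
    revert h1 h3
    generalize (R.filter fun r => r.val < g).card = g'
    intro h3 h1
    omega

end Summit.QuantumAdvantage.AdviceFreeQNC0

end
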